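import Literature.NumberTheory.EllipticCurves.IsogenyTwoTorsionProofs
import Literature.NumberTheory.EllipticCurves.IsogenyCompProofs
import Literature.NumberTheory.EllipticCurves.TwoDescent
import HarnessLib

/-!
# The three `2`-isogenies of an elliptic curve with full rational `2`-torsion

For an elliptic curve `E/K` (`char K = 0`) with rational `2`-torsion `e₁, e₂, e₃` (`SplitTwoTorsion`, the tree's
hypothesis of the complete `2`-descent, `TwoDescent.lean`), translating `Tᵢ = (eᵢ, *)` to the origin and completing
the square puts `E` in two-torsion normal form `y² = x³ + a x² + b x` with `a = (eᵢ - eⱼ) + (eᵢ - eₖ)`,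
`b = (eᵢ - eⱼ)(eᵢ - eₖ)`, and Silverman's explicit `2`-isogeny (AEC III.4.5; tree `twoIsogeny`,
`IsogenyTwoTorsionProofs.lean`) lands in `E/⟨Tᵢ⟩ : Y² = X³ - 2aX² + (a² - 4b)X`, of discriminant
`256 b (a² - 4b)² = 256 (eᵢ - eⱼ)(eᵢ - eₖ)(eⱼ - eₖ)⁴`. Hence:

* `exists_isogeny_degree_two_Δ_eq` — **there is a `K`-isogeny `E → E′` of degree `2` onto a curve with
  `Δ(E′) = 256 · (e₁ - e₂)(e₁ - e₃) · (e₂ - e₃)⁴`** (and the two permuted statements via `h.swap₁₂`,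
  `h.swap₂₃.swap₁₂`): the `2`-division field of `E/⟨T₁⟩` is `K(√δ₁)`, `δ₁ = (e₁ - e₂)(e₁ - e₃)` — the datum behind
  "admissible primes are inert in `ℚ(E′[2])`" (Shu–Zhai 2021, Def. 1.1) for a full-torsion curve.

Theorems only; no named fact. Cell `bsd-f1-sign2` (LEAD gk2-p1): reading of the hypothesis `IsFullAdmissible` of
LINE 49 «full_vertex» (crux R″ `RankOneTwoTorsionResidualAtTwo`), toward stub D0≤2.

## References

* [SilvermanAEC2009] J. H. Silverman, *The Arithmetic of Elliptic Curves*, 2nd ed., GTM 106, Springer 2009,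
  III.4 Example 4.5, Prop. X.1.4, X.4 Example 4.8 / Prop. X.4.9.
* [ShuZhai2021] J. Shu, S. Zhai, arXiv:2102.11808, Def. 1.1.
-/

noncomputable section

open scoped Classical

universe u

namespace WeierstrassCurve

open WeierstrassCurve.Affine

variable {K : Type u} [Field K] [CharZero K] (W : WeierstrassCurve K) [W.IsElliptic] {e₁ e₂ e₃ : K}

omit [W.IsElliptic] in
/-- The translation-and-shear putting `T₁ = (e₁, *)` at the origin with `a₁ = a₃ = 0`: two-torsion normal form
`y² = x³ + ((e₁-e₂)+(e₁-e₃)) x² + (e₁-e₂)(e₁-e₃) x`. [cite: SilvermanAEC2009, III.4 Example 4.5, Prop. X.1.4] -/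
theorem variableChange_twoTorsionNF (h : W.toAffine.SplitTwoTorsion e₁ e₂ e₃) :
    let C : VariableChange K := ⟨1, e₁, -W.a₁ / 2, W.toAffine.twoTorsionY e₁⟩
    (C • W).a₁ = 0 ∧ (C • W).a₃ = 0 ∧ (C • W).a₆ = 0 ∧
      (C • W).a₂ = (e₁ - e₂) + (e₁ - e₃) ∧ (C • W).a₄ = (e₁ - e₂) * (e₁ - e₃) := by
  intro C
  have hb2 := h.a₂_eq
  have hb4 := h.a₄_eq
  have hb6 := h.a₆_eq
  have heq := (equation_iff _ _).mp (equation_twoTorsion h)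
  simp only [twoTorsionY] at heq
  refine ⟨?_, ?_, ?_, ?_, ?_⟩
  · rw [variableChange_a₁]; simp only [C, inv_one, Units.val_one, one_mul]; ring
  · rw [variableChange_a₃]; simp only [C, inv_one, Units.val_one, one_pow, one_mul, twoTorsionY]; ring
  · rw [variableChange_a₆]; simp only [C, inv_one, Units.val_one, one_pow, one_mul, twoTorsionY]
    linear_combination -heq
  · rw [variableChange_a₂]; simp only [C, inv_one, Units.val_one, one_pow, one_mul]
    linear_combination (1 / 4 : K) * hb2
  · rw [variableChange_a₄]; simp only [C, inv_one, Units.val_one, one_pow, one_mul, twoTorsionY]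
    linear_combination (1 / 2 : K) * hb4 + (e₁ / 2) * hb2

/-- **The `2`-isogeny `E → E/⟨T₁⟩` of a curve with rational `2`-torsion**: a `K`-isogeny of degree `2` onto a curve of
discriminant `256 · (e₁-e₂)(e₁-e₃) · (e₂-e₃)⁴`, whose `2`-division field is therefore `K(√((e₁-e₂)(e₁-e₃)))`.
(For `T₂`, `T₃` use `h.swap₁₂`, `h.swap₂₃.swap₁₂`.) [cite: SilvermanAEC2009, III.4 Example 4.5, X.4 Prop. X.4.9]
[cite: ShuZhai2021, Def. 1.1] -/
theorem exists_isogeny_degree_two_Δ_eq (h : W.toAffine.SplitTwoTorsion e₁ e₂ e₃) :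
    ∃ (V : WeierstrassCurve K) (_ : V.IsElliptic) (φ : Isogeny W V),
      φ.degree = 2 ∧ V.Δ = 256 * ((e₁ - e₂) * (e₁ - e₃)) * (e₂ - e₃) ^ 4 := by
  let C : VariableChange K := ⟨1, e₁, -W.a₁ / 2, W.toAffine.twoTorsionY e₁⟩
  obtain ⟨ha₁, ha₃, ha₆, ha₂, ha₄⟩ := W.variableChange_twoTorsionNF h
  haveI : (C • W).IsTwoTorsionNF := ⟨ha₁, ha₃, ha₆⟩
  refine ⟨(C • W).twoIsogenyCodomain, inferInstance, (C • W).twoIsogeny.comp (VariableChange.toIsogeny W C), ?_, ?_⟩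
  · -- degree: the kernel of the composite is the preimage of `ker (twoIsogeny)` under a bijection
    unfold Isogeny.degree
    rw [Isogeny.ker_comp]
    have e : ((C • W).twoIsogeny.toAddMonoidHom.ker.comap (VariableChange.toIsogeny W C).toAddMonoidHom) ≃
        (C • W).twoIsogeny.toAddMonoidHom.ker :=
      { toFun := fun x => ⟨VariableChange.toIsogeny W C x.1, x.2⟩
        invFun := fun y => ⟨(VariableChange.toIsogeny_surjective W C y.1).choose, by
          rw [AddSubgroup.mem_comap]
          show (VariableChange.toIsogeny W C) _ ∈ _
          rw [(VariableChange.toIsogeny_surjective W C y.1).choose_spec]; exact y.2⟩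
        left_inv := fun x => Subtype.ext (VariableChange.toIsogeny_injective W C
          ((VariableChange.toIsogeny_surjective W C _).choose_spec))
        right_inv := fun y => Subtype.ext ((VariableChange.toIsogeny_surjective W C y.1).choose_spec) }
    rw [Nat.card_congr e]
    exact (C • W).degree_twoIsogeny
  · rw [twoIsogenyCodomain_Δ, ha₂, ha₄]; ring

end WeierstrassCurve

end
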